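import Summits.QuantumFields.YangMills.Theorems.FluctuationComparisonRegPrIntLLoopLedgerGasOfAtomGas
import HarnessLib

/-!
# SINGLETON ABSORPTION: GREP's one-atom normalisations `Z1_b` go INSIDE the hard-core gas — `(Π_b (1 + z_b)) · Ξ_{≥2}(K) = Ξ_{all}(w′)` with `w′{b} = z_b`,
# `w′ X = K X · Π_{b ∈ X} (1 + z_b)` (generic identity of hard-core subset gases; the last currency step between GREP's normalised output and the GAS format)

Cell `ym3-torus` (YM ladder rung R3 = continuum `SU(2)` Yang–Mills on the three-torus — a RUNG, NOT d = 4, NOT infinite volume, NOT a mass gap, NOT Clay).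
Width seat `ym3-torus-px20` (gen 15); `--supports stmt-QuantumFields-20520 --as helper`, count-neutral, definition-free, default heartbeats; registry v11.4 №36
untouched.  GREP (AnchorGap `stub_gaussianBBFPolymerRep`) concludes `E_C[Π_b G_b] ∕ Π_b Z1_b = Ξ_{|X| ≥ 2}(K)`: the NORMALISED full expectation is a hard-core gas over atom sets
of size `≥ 2`.  The GAS∕GAS₁ format of LINE g19-2 (and the sockets ✓`…GasOfProductFormula`, ✓`…GasOfKPFamily`, ✓`…GasOfAtomGas`) wants ONE gas carrying everything that
depends on the field — including the one-atom factors `Z1_b = 1 + z_b` (local, `O(g²)`-close to `1`).  This file proves the generic identity that does it: for a hard-core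
(`polyInc` = equal-or-overlapping) gas on the subsets of a finite atom set,

  `Ξ(𝓑 ∪ {{b} : b ∈ T}; w) = Σ_{F ⊆ 𝓑 compatible} (Π_{X ∈ F} w X) · Π_{c ∈ T ∖ ⋃F} (1 + w{c})`   (every atom of `T` not covered by `F` is either a singleton polymer or absent),

whence, for `w{b} = z_b` and `w X = K X · Π_{b∈X}(1 + z_b)` on the family `𝓑` of sets of size `≥ 2`: `Ξ_{all nonempty}(w) = (Π_b (1 + z_b)) · Ξ_𝓑(K)`, and, with `w ∅ = 0`,
the same over ALL subsets (✓`polymerPartitionFunction_eq_of_vanish_off`).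
* §1 `not_polyInc_singleton_iff`, `polyInc_symm'`, ★`polymerPartitionFunction_union_singletons` (induction on `T` via lit ✓`polymerPartitionFunction_insert`).
* §2 `prod_biUnion_of_isCompatible` (compatible = pairwise disjoint ⇒ `Π_{X∈F} Π_{b∈X} = Π_{b∈⋃F}`), ★★`polymerPartitionFunction_absorb_singletons`, and the GREP-shaped corollary
  ★★`gas_of_normalised_gas` (`E ∕ Π Z1 = Ξ_{≥2}(K)`, `Z1_b ≠ 0` ⟹ `E = Ξ_{univ}(w)` for `w{b} = Z1_b − 1`, `w X = K X · Π_{b∈X} Z1_b`, `w = 0` elsewhere).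

HONEST SCOPE.  [folklore] finite combinatorics of hard-core subset gases; nothing of GREP (a HYPOTHESIS shape here), of Bałaban's expansions, of GAS∕REP∕H4ᶜ∕S2β or of
`FluctuationComparisonRegPrIntL` (stmt-QuantumFields-20520) is proved; no summit statement is proved by a helper; rung R3 = SU(2) YM₃ on T³ — NOT d = 4, NOT infinite volume, NOT a
mass gap, NOT Clay; the Yang–Mills mass gap is NOT proved.

References: D. C. Brydges, *A short course on cluster expansions*, Les Houches 1984 [Brydges1986] (§3); V. Mastropietro, *Non-Perturbative Renormalization* (2008) §2.8
[Mastropietro2008]; R. Kotecký, D. Preiss, CMP **103** (1986) 491–498 [KoteckyPreiss1986].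
-/

set_option autoImplicit false

noncomputable section

open Finset
open Literature.Probability.LatticeModels

namespace Summit.QuantumFields.YangMills.Theorems.LoopLedgerGasSingletonAbsorption

variable {β : Type*} [DecidableEq β]

/-! ## §1 Adding singleton polymers one atom at a time -/

omit [DecidableEq β] in
/-- `polyInc` is symmetric (in the form the `PolymerGas` lemmas take). [folklore] -/
theorem polyInc_symm' [DecidableEq β] : ∀ X Y : Finset β, polyInc X Y → polyInc Y X := fun X Y h => by
  rcases h with h | h
  · exact Or.inl h.symm
  · exact Or.inr (by rwa [Finset.inter_comm])

/-- A polymer is compatible with the singleton `{b}` iff it is not `{b}` and does not contain `b`. [folklore] -/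
theorem not_polyInc_singleton_iff (b : β) (X : Finset β) : ¬ polyInc ({b} : Finset β) X ↔ X ≠ {b} ∧ b ∉ X := by
  unfold polyInc
  rw [not_or]
  refine and_congr ⟨fun h h' => h h'.symm, fun h h' => h h'.symm⟩ ?_
  rw [Finset.not_nonempty_iff_eq_empty, Finset.singleton_inter]
  split_ifs with h
  · simp [h]
  · simp [h]

/-- The complement-of-cover product after inserting a fresh atom `b ∉ T`: it picks up the factor `1 + w{b}` exactly when `b` is not covered. [folklore] -/
theorem prod_insert_sdiff (w : Finset β → ℂ) {T : Finset β} {b : β} (hb : b ∉ T) (U : Finset β) :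
    ∏ c ∈ insert b T \ U, (1 + w {c}) = (if b ∈ U then 1 else (1 + w {b})) * ∏ c ∈ T \ U, (1 + w {c}) := by
  by_cases hU : b ∈ U
  · rw [if_pos hU, one_mul, Finset.insert_sdiff_of_mem T hU]
  · rw [if_neg hU, Finset.insert_sdiff_of_notMem T hU, Finset.prod_insert (fun h => hb (Finset.mem_sdiff.1 h).1)]

/-- Sub-families none of whose members contains `b` are the sub-families of the `b`-avoiding part. [folklore] -/
theorem mem_powerset_filter_notMem_iff (𝓑 : Finset (Finset β)) (b : β) (F : Finset (Finset β)) :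
    F ∈ (𝓑.filter fun X => b ∉ X).powerset ↔ F ∈ 𝓑.powerset ∧ b ∉ F.biUnion id := by
  simp only [Finset.mem_powerset, Finset.subset_iff, Finset.mem_filter, Finset.mem_biUnion, id, not_exists, not_and]
  exact ⟨fun h => ⟨fun X hX => (h hX).1, fun X hX => (h hX).2⟩, fun h X hX => ⟨h.1 hX, h.2 X hX⟩⟩

/-- ★ **Ξ WITH SINGLETONS ADJOINED.**  For a family `𝓑` of polymers of size `≥ 2` and a set `T` of atoms,
`Ξ(𝓑 ∪ {{b} : b ∈ T}; w) = Σ_{F ⊆ 𝓑 compatible} (Π_{X∈F} w X) · Π_{c ∈ T ∖ ⋃F} (1 + w{c})` (induction on `T`: adjoining `{b}` adds `w{b}·Ξ` of the `b`-avoiding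
part, lit ✓`polymerPartitionFunction_insert`). [cite: Brydges1986, §3] -/
theorem polymerPartitionFunction_union_singletons (w : Finset β → ℂ) (T : Finset β) :
    ∀ (𝓑 : Finset (Finset β)), (∀ X ∈ 𝓑, 2 ≤ X.card) →
      polymerPartitionFunction polyInc w (𝓑 ∪ T.image fun b => ({b} : Finset β)) =
        ∑ F ∈ 𝓑.powerset, if IsCompatible polyInc F then (∏ X ∈ F, w X) * ∏ c ∈ T \ F.biUnion id, (1 + w {c}) else 0 := by
  induction T using Finset.induction_on with
  | empty =>
    intro 𝓑 _
    rw [Finset.image_empty, Finset.union_empty]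
    unfold polymerPartitionFunction
    refine Finset.sum_congr rfl fun F _ => ?_
    split_ifs
    · rw [Finset.empty_sdiff, Finset.prod_empty, mul_one]
    · rfl
  | insert b T hb ih =>
    intro 𝓑 h𝓑
    have hnot𝓑 : ({b} : Finset β) ∉ 𝓑 := fun h => by have := h𝓑 _ h; simp at this
    have hnotS : ({b} : Finset β) ∉ T.image fun c => ({c} : Finset β) := by
      rw [Finset.mem_image]; rintro ⟨c, hc, hcb⟩
      exact hb (Finset.singleton_injective hcb ▸ hc)
    rw [Finset.image_insert, Finset.union_insert,
      polymerPartitionFunction_insert polyInc_symm' w (fun h => (Finset.mem_union.1 h).elim hnot𝓑 hnotS)]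
    -- the `b`-avoiding part of `𝓑 ∪ singletons(T)` is `𝓑.filter (b ∉ ·) ∪ singletons(T)`
    have hfilter : (𝓑 ∪ T.image fun c => ({c} : Finset β)).filter (fun X => ¬ polyInc ({b} : Finset β) X) =
        𝓑.filter (fun X => b ∉ X) ∪ T.image fun c => ({c} : Finset β) := by
      ext X
      simp only [Finset.mem_filter, Finset.mem_union, Finset.mem_image, not_polyInc_singleton_iff]
      constructor
      · rintro ⟨hX | ⟨c, hc, rfl⟩, hne, hnb⟩
        · exact Or.inl ⟨hX, hnb⟩
        · exact Or.inr ⟨c, hc, rfl⟩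
      · rintro (⟨hX, hnb⟩ | ⟨c, hc, rfl⟩)
        · exact ⟨Or.inl hX, fun h => by have := h𝓑 _ hX; rw [h] at this; simp at this, hnb⟩
        · refine ⟨Or.inr ⟨c, hc, rfl⟩, fun h => hb ?_, fun h => hb ?_⟩
          · rw [Finset.singleton_injective h] at hc; exact hc
          · rw [Finset.mem_singleton] at h; rw [h]; exact hc
    rw [hfilter, ih 𝓑 h𝓑, ih (𝓑.filter fun X => b ∉ X) (fun X hX => h𝓑 X (Finset.mem_filter.1 hX).1)]
    -- split the target sum according to whether `b` is covered
    have hsplit : ∀ F ∈ 𝓑.powerset,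
        (if IsCompatible polyInc F then (∏ X ∈ F, w X) * ∏ c ∈ insert b T \ F.biUnion id, (1 + w {c}) else 0) =
          (if IsCompatible polyInc F then (∏ X ∈ F, w X) * ∏ c ∈ T \ F.biUnion id, (1 + w {c}) else 0) +
          w {b} * (if b ∉ F.biUnion id then
            (if IsCompatible polyInc F then (∏ X ∈ F, w X) * ∏ c ∈ T \ F.biUnion id, (1 + w {c}) else 0) else 0) := by
      intro F _
      by_cases hc : IsCompatible polyInc F
      · simp only [if_pos hc, prod_insert_sdiff w hb]
        by_cases hU : b ∈ F.biUnion id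
        · rw [if_pos hU, if_neg (not_not.2 hU)]; ring
        · rw [if_neg hU, if_pos hU]; ring
      · simp only [if_neg hc]
        split_ifs <;> ring
    -- the families not covering `b` are the sub-families of `𝓑.filter (b ∉ ·)`
    have hpow : (𝓑.filter fun X => b ∉ X).powerset = 𝓑.powerset.filter fun F => b ∉ F.biUnion id := by
      ext F
      rw [Finset.mem_filter, mem_powerset_filter_notMem_iff]
    rw [Finset.sum_congr rfl hsplit, Finset.sum_add_distrib, ← Finset.mul_sum, hpow, Finset.sum_filter]

/-! ## §2 Absorbing the one-atom factors -/

/-- For a compatible family (pairwise disjoint polymers) a product over members then elements is a product over the cover. [folklore] -/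
theorem prod_biUnion_of_isCompatible {F : Finset (Finset β)} (hF : IsCompatible polyInc F) (f : β → ℂ) :
    ∏ X ∈ F, ∏ b ∈ X, f b = ∏ b ∈ F.biUnion id, f b := by
  rw [Finset.prod_biUnion]
  · rfl
  · intro X hX Y hY hXY
    have h : ¬ polyInc X Y := hF hX hY hXY
    unfold polyInc at h
    rw [not_or, Finset.not_nonempty_iff_eq_empty] at h
    show Disjoint X Y
    exact Finset.disjoint_iff_inter_eq_empty.2 h.2

/-- ★★ **SINGLETON ABSORPTION.**  `𝓑` = a family of polymers of size `≥ 2` on the finite atom set `β`; activities with `w{b} = z b` and `w X = K X · Π_{b∈X}(1 + z b)` on `𝓑`: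
`Ξ(𝓑 ∪ all singletons; w) = (Π_b (1 + z b)) · Ξ(𝓑; K)`. [cite: Brydges1986, §3] -/
theorem polymerPartitionFunction_absorb_singletons [Fintype β] (𝓑 : Finset (Finset β)) (h𝓑 : ∀ X ∈ 𝓑, 2 ≤ X.card)
    (z : β → ℂ) (K w : Finset β → ℂ) (hw1 : ∀ b, w {b} = z b) (hw2 : ∀ X ∈ 𝓑, w X = K X * ∏ b ∈ X, (1 + z b)) :
    polymerPartitionFunction polyInc w (𝓑 ∪ (Finset.univ : Finset β).image fun b => ({b} : Finset β)) =
      (∏ b, (1 + z b)) * polymerPartitionFunction polyInc K 𝓑 := by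
  rw [polymerPartitionFunction_union_singletons w Finset.univ 𝓑 h𝓑]
  unfold polymerPartitionFunction
  rw [Finset.mul_sum]
  refine Finset.sum_congr rfl fun F hF => ?_
  have hF𝓑 : F ⊆ 𝓑 := Finset.mem_powerset.1 hF
  split_ifs with hc
  · rw [Finset.prod_congr rfl fun X hX => hw2 X (hF𝓑 hX), Finset.prod_mul_distrib, prod_biUnion_of_isCompatible hc]
    simp_rw [hw1]
    rw [mul_assoc, ← Finset.prod_union (Finset.disjoint_sdiff), Finset.union_sdiff_of_subset (Finset.subset_univ _)]
    ring
  · rw [mul_zero]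

/-- ★★ **THE GREP-SHAPED COROLLARY.**  If a normalised quantity satisfies `E ∕ Π_b Z1_b = Ξ(𝓑; K)` with `Z1_b ≠ 0` (GREP's conclusion shape, `𝓑` the sets of size `≥ 2`), then
`E = Ξ(all subsets; w)` for any activities with `w{b} = Z1_b − 1`, `w X = K X · Π_{b∈X} Z1_b` on `𝓑`, and `w = 0` on every other subset (in particular on `∅`) — ONE field-dependent
hard-core gas, as the GAS format wants. [cite: Brydges1986, §3] -/
theorem gas_of_normalised_gas [Fintype β] (𝓑 : Finset (Finset β)) (h𝓑 : ∀ X ∈ 𝓑, 2 ≤ X.card)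
    (Z1 : β → ℂ) (hZ1 : ∀ b, Z1 b ≠ 0) (K w : Finset β → ℂ) (E : ℂ)
    (hE : E / ∏ b, Z1 b = polymerPartitionFunction polyInc K 𝓑)
    (hw1 : ∀ b, w {b} = Z1 b - 1) (hw2 : ∀ X ∈ 𝓑, w X = K X * ∏ b ∈ X, Z1 b)
    (hwoff : ∀ X : Finset β, X ∉ 𝓑 → X.card ≠ 1 → w X = 0) :
    E = polymerPartitionFunction polyInc w Finset.univ := by
  have hprod : ∏ b, Z1 b ≠ 0 := Finset.prod_ne_zero_iff.2 fun b _ => hZ1 b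
  have hE' : E = (∏ b, Z1 b) * polymerPartitionFunction polyInc K 𝓑 := by
    rw [← hE, mul_div_cancel₀ _ hprod]
  -- restrict `univ` to `𝓑 ∪ singletons` (activities vanish elsewhere)
  rw [LoopLedgerGasOfAtomGas.polymerPartitionFunction_eq_of_vanish_off polyInc_symm' w
    (Finset.subset_univ (𝓑 ∪ (Finset.univ : Finset β).image fun b => ({b} : Finset β))) ?_]
  · rw [hE', polymerPartitionFunction_absorb_singletons 𝓑 h𝓑 (fun b => Z1 b - 1) K w (fun b => hw1 b)
      (fun X hX => by rw [hw2 X hX]; exact congrArg _ (Finset.prod_congr rfl fun b _ => by ring))]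
    congr 1
    exact Finset.prod_congr rfl fun b _ => by ring
  · intro X _ hX
    rw [Finset.mem_union, not_or, Finset.mem_image] at hX
    refine hwoff X hX.1 fun hcard => hX.2 ?_
    obtain ⟨b, rfl⟩ := Finset.card_eq_one.1 hcard
    exact ⟨b, Finset.mem_univ b, rfl⟩

end Summit.QuantumFields.YangMills.Theorems.LoopLedgerGasSingletonAbsorption

end
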